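import Mathlib
import HarnessLib
import Summits.HubbardSuperconductivity.HubbardSuperconductivity.Theses.LiebTwin
import Summits.HubbardSuperconductivity.HubbardSuperconductivity.Theorems.EnslavedA1gLowerSandwich
import Literature.MathematicalPhysics.QuantumLattice.HubbardModelProofs
import Literature.MathematicalPhysics.QuantumLattice.HubbardSzSectorLadder

/-!
# Crux `NoOnsiteODLRO` (stmt-HubbardSuperconductivity-0933) — the `η`-vacuum of the strict pair window

Pseudospin bookkeeping for the repulsive Hubbard torus `H = hubbardTorus 2 L 1 U` on `(ℤ/Lℤ)²`, `L` even,
with Yang's STAGGERED pair operators `η† = etaRaise torusStagger`, `η = etaLower torusStagger`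
(`[H, η†] = U η†`, tree `etaRaise_commutator_holds`):

* `pairAnnihilation_comm`, `etaLower_mul_etaLower_comm` — on-site pair annihilators `c_{x↓}c_{x↑}` commute with
  each other, hence so do any two `η`-lowering operators `etaLower ε`, `etaLower ε'` (in particular the
  staggered `η` and the unstaggered `η₁ = etaLower 1 = -(pairField sWave L)/√2`);
* `hubbardTorus_mul_etaLower` — the adjoint Yang relation `H η = η H - U η`;
* `isInSector_etaLower_mulVec` — `η` maps Lieb's sector `(a+1, b+1)` to `(a, b)`;
* `etaLower_groundState_eq_zero_of_window` — **the `η`-vacuum of the strict window**: if `ψ` is a ground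
  state of `H` in the joint sector `(N, S^z = 0)` and the pair window is STRICT,
  `w := U - (E(N,0) - E(N-2,0)) > 0` (`E(M,0) = minEnergyOn H (szSector M 0)`), then `η ψ = 0`.
  Proof: `H (ηψ) = (E(N,0) - U) ηψ` lies in the sector `(N-2, 0)`, where `H ≥ E(N-2,0) > E(N,0) - U`.

So under a strict window every sector ground state is a LOWEST-WEIGHT vector of Yang's pseudospin `SU(2)`
(pseudospin `j = (L² - N)/2`, `η^z = -j`); this is the input of the pseudospin ceiling on the on-site pair
structure factor (`LiebTwinNoOnsiteODLROPseudospinCeiling.lean`). Crux-strategist census by-product B1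
(`Cruxes/NoOnsiteODLRO/STRATEGY-CENSUS.md`).

Sources: C. N. Yang, PRL 63 (1989) 2144, eqs. (4)–(6); S. C. Zhang, PRL 65 (1990) 120 (pseudospin `SU(2)`);
C. N. Yang, S. C. Zhang, Mod. Phys. Lett. B 4 (1990) 759; H. Tasaki, *Physics and Mathematics of Quantum
Many-Body Systems* (2020) §2.1 (variational principle). All statements are folklore given the tree's Yang
commutator; no definition is introduced.
-/

noncomputable section

-- the mandated namespace `Summit.<Summit>.<Problem>.Theorems` repeats `HubbardSuperconductivity`
-- (single-problem summit, D-0017), which the `dupNamespace` linter flags on every declaration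
set_option linter.dupNamespace false

namespace Summit.HubbardSuperconductivity.HubbardSuperconductivity.Theorems.NoOnsiteODLRO.Pseudospin

open Matrix Finset
open Literature.Probability.LatticeModels Literature.MathematicalPhysics.QuantumLattice
open scoped ComplexOrder

/-! ### Pair annihilators commute -/

section Ring

variable {R : Type*} [Ring R]

/-- Four pairwise anticommuting elements: the products `ab` and `cd` commute (an even number of
transpositions). [folklore] -/
theorem mul_mul_comm_of_anticomm {a b c d : R} (hbc : b * c = -(c * b)) (hbd : b * d = -(d * b))
    (hac : a * c = -(c * a)) (had : a * d = -(d * a)) : a * b * (c * d) = c * d * (a * b) := by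
  calc a * b * (c * d) = a * (b * c) * d := by noncomm_ring
    _ = -(a * c * b * d) := by rw [hbc]; noncomm_ring
    _ = c * a * (b * d) := by rw [hac]; noncomm_ring
    _ = -(c * (a * d) * b) := by rw [hbd]; noncomm_ring
    _ = c * d * (a * b) := by rw [had]; noncomm_ring

end Ring

section CAR

variable {Λ : Type*} [LinearOrder Λ] [Fintype Λ]

/-- **On-site pair annihilators commute**: `(c_{x↓}c_{x↑})(c_{y↓}c_{y↑}) = (c_{y↓}c_{y↑})(c_{x↓}c_{x↑})`
(CAR: annihilation operators pairwise anticommute). Essler et al., *The One-Dimensional Hubbard Model*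
(2005) §2.2.5. [folklore] -/
theorem pairAnnihilation_comm (x y : Λ) :
    annihilation (orb x 1) * annihilation (orb x 0) * (annihilation (orb y 1) * annihilation (orb y 0)) =
      annihilation (orb y 1) * annihilation (orb y 0) *
        (annihilation (orb x 1) * annihilation (orb x 0)) := by
  have h : ∀ i j : Orb Λ, annihilation i * annihilation j = -(annihilation j * annihilation i) :=
    fun i j => eq_neg_of_add_eq_zero_left (annihilation_anticommute_holds i j)
  exact mul_mul_comm_of_anticomm (h _ _) (h _ _) (h _ _) (h _ _)

/-- **Any two `η`-lowering operators commute**: `etaLower ε * etaLower ε' = etaLower ε' * etaLower ε`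
(both are sign-weighted sums of the commuting on-site pair annihilators). Yang, PRL 63 (1989) 2144,
eq. (4). [folklore] -/
theorem etaLower_mul_etaLower_comm (ε ε' : Λ → ℤˣ) :
    etaLower ε * etaLower ε' = etaLower ε' * etaLower ε := by
  rw [EtaPairingODLRO.etaLower_eq_sum' ε, EtaPairingODLRO.etaLower_eq_sum' ε']
  simp only [Finset.sum_mul, Finset.mul_sum, smul_mul_assoc, mul_smul_comm, Finset.smul_sum]
  rw [Finset.sum_comm]
  refine Finset.sum_congr rfl fun a _ => Finset.sum_congr rfl fun b _ => ?_
  rw [pairAnnihilation_comm a b]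
  exact smul_comm _ _ _

/-- `η_ε` maps Lieb's sector `(a + 1, b + 1)` to `(a, b)` (it removes one `↑` and one `↓` electron).
Yang, PRL 63 (1989) 2144, eq. (4); Lieb, PRL 62 (1989) 1201, eq. (2). [folklore] -/
theorem isInSector_etaLower_mulVec {a b : ℕ} {φ : Fock (Orb Λ)} (hφ : IsInSector (a + 1) (b + 1) φ)
    (ε : Λ → ℤˣ) : IsInSector a b (etaLower ε *ᵥ φ) := by
  rw [EtaPairingODLRO.etaLower_eq_sum', sum_mulVec]
  refine IsInSector.sum fun x _ => ?_
  rw [smul_mulVec, ← mulVec_mulVec]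
  exact ((hφ.annihilation_up_mulVec x).annihilation_down_mulVec x).smul _

end CAR

/-! ### The torus: adjoint Yang relation and the `η`-vacuum -/

section Torus

variable {L : ℕ}

/-- **Adjoint Yang relation** on the torus of even side: `H η = η H - U η` for `H = hubbardTorus 2 L 1 U`
and the staggered `η = etaLower torusStagger` (adjoint of `[H, η†] = U η†`, `H` Hermitian).
Yang, PRL 63 (1989) 2144, eq. (6). [folklore] -/
theorem hubbardTorus_mul_etaLower (hL : Even L) (U : ℝ) :
    hubbardTorus 2 L 1 U * etaLower torusStagger =
      etaLower torusStagger * hubbardTorus 2 L 1 U - (U : ℂ) • etaLower torusStagger := by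
  have h := etaRaise_commutator_holds (d := 2) (L := L) hL 1 U 0
  rw [hubbardTorusWith_zero, mul_zero, sub_zero] at h
  have hH : (hubbardTorus 2 L 1 U)ᴴ = hubbardTorus 2 L 1 U :=
    (LiebThm1.hamiltonian_isHermitian (fermionTorusGraph 2 L) 1 U).eq
  have h2 := congrArg conjTranspose h
  rw [conjTranspose_sub, conjTranspose_mul, conjTranspose_mul, conjTranspose_smul, hH] at h2
  change etaLower torusStagger * hubbardTorus 2 L 1 U - hubbardTorus 2 L 1 U * etaLower torusStagger =
    star (U : ℂ) • etaLower torusStagger at h2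
  rw [Complex.star_def, Complex.conj_ofReal] at h2
  calc hubbardTorus 2 L 1 U * etaLower torusStagger
      = etaLower torusStagger * hubbardTorus 2 L 1 U -
          (etaLower torusStagger * hubbardTorus 2 L 1 U -
            hubbardTorus 2 L 1 U * etaLower torusStagger) := by abel
    _ = etaLower torusStagger * hubbardTorus 2 L 1 U - (U : ℂ) • etaLower torusStagger := by rw [h2]

/-- **The `η`-vacuum of the strict pair window** (crux-strategist by-product B1 for `NoOnsiteODLRO`).
Let `L` be even, `ψ` a ground state of `H = hubbardTorus 2 L 1 U` in the joint sector `(N, S^z = 0)`,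
`N ≥ 2`, and suppose the pair window is strict, `0 < U - (E(N,0) - E(N-2,0))` with
`E(M,0) = minEnergyOn H (szSector M 0)`. Then `η ψ = 0` for the staggered `η = etaLower torusStagger`:
`ηψ` lies in the sector `(N-2, 0)` and satisfies `H ηψ = (E(N,0) - U) ηψ` (adjoint Yang relation),
while `H ≥ E(N-2,0) > E(N,0) - U` there. Equivalently, `ψ` is a lowest-weight vector of Yang's pseudospin
`SU(2)`. Yang, PRL 63 (1989) 2144; Zhang, PRL 65 (1990) 120; Tasaki (2020) §2.1. [folklore] -/
theorem etaLower_groundState_eq_zero_of_window (hL : Even L) (U : ℝ) {N : ℕ} (hN : 2 ≤ N)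
    {ψ : Fock (Orb (FermionTorus 2 L))} (hψ : IsGroundStateInSector (hubbardTorus 2 L 1 U) N 0 ψ)
    (hw : 0 < U - ((hubbardTorus 2 L 1 U).minEnergyOn (szSector N 0) -
      (hubbardTorus 2 L 1 U).minEnergyOn (szSector (N - 2) 0))) :
    etaLower torusStagger *ᵥ ψ = 0 := by
  obtain ⟨hmem, hne, hHψ⟩ := hψ
  obtain ⟨n, rfl, hncard⟩ :=
    Summit.HubbardSuperconductivity.HubbardSuperconductivity.Theorems.WcbcsSlater.exists_eq_two_mul_of_mem_szSector_zero
      hmem hne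
  obtain ⟨m, rfl⟩ : ∃ m, n = m + 1 := ⟨n - 1, by omega⟩
  have h2m : 2 * (m + 1) - 2 = 2 * m := by omega
  rw [h2m] at hw
  set H := hubbardTorus 2 L 1 U with hHdef
  set E : ℝ := H.minEnergyOn (szSector (2 * (m + 1)) 0) with hEdef
  set E' : ℝ := H.minEnergyOn (szSector (2 * m) 0) with hE'def
  set φ : Fock (Orb (FermionTorus 2 L)) := etaLower torusStagger *ᵥ ψ with hφdef
  -- sectors
  have hψsec : IsInSector (m + 1) (m + 1) ψ := (mem_szSector_two_mul_zero_iff (m + 1) ψ).1 hmem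
  have hφsec : IsInSector m m φ := isInSector_etaLower_mulVec hψsec torusStagger
  -- the eigenvalue equation `H φ = (E - U) φ`
  have hHφ : H *ᵥ φ = ((E - U : ℝ) : ℂ) • φ := by
    rw [hφdef, mulVec_mulVec, hHdef, hubbardTorus_mul_etaLower hL U, sub_mulVec, ← mulVec_mulVec,
      ← hHdef, hHψ, mulVec_smul, smul_mulVec, ← sub_smul, Complex.ofReal_sub]
  -- the variational principle in the lower sector
  have hm : m ≤ Fintype.card (FermionTorus 2 L) := by omega
  have hvar := (szSector_groundState (fermionTorusGraph 2 L) 1 U hm).2 φ hφsec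
  change E' * (star φ ⬝ᵥ φ).re ≤ (star φ ⬝ᵥ (H *ᵥ φ)).re at hvar
  rw [hHφ, dotProduct_smul, smul_eq_mul, Complex.re_ofReal_mul] at hvar
  -- `(E' - E + U) ‖φ‖² ≤ 0` with `E' - E + U > 0`
  have hnn : 0 ≤ (star φ ⬝ᵥ φ).re := (Complex.nonneg_iff.mp (dotProduct_star_self_nonneg _)).1
  have hzero : (star φ ⬝ᵥ φ).re = 0 := by nlinarith
  have hzeroC : star φ ⬝ᵥ φ = 0 := by
    have him : (star φ ⬝ᵥ φ).im = 0 := (Complex.nonneg_iff.mp (dotProduct_star_self_nonneg _)).2.symm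
    exact Complex.ext hzero him
  exact (LiebThm1.star_dotProduct_self_eq_zero_iff φ).1 hzeroC

/-- **Registered stub `stub_etaVacuumOfStrictWindow`** of crux `NoOnsiteODLRO`
(stmt-HubbardSuperconductivity-0933; crux-strategist by-product B1, not a piece of a line composition):
on the torus of even side, a strict pair window `0 < U - (E(N,0) - E(N-2,0))` forces every ground state
of the joint sector `(N, S^z = 0)`, `N ≥ 2`, into the kernel of Yang's staggered `η`
(`etaLower_groundState_eq_zero_of_window`). Yang, PRL 63 (1989) 2144; Zhang, PRL 65 (1990) 120.
[folklore] -/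
theorem stub_etaVacuumOfStrictWindow :
    ∀ (L : ℕ) [NeZero L], Even L → ∀ (U : ℝ) (N : ℕ) (ψ : Fock (Orb (FermionTorus 2 L))), 2 ≤ N →
      IsGroundStateInSector (hubbardTorus 2 L 1 U) N 0 ψ →
        0 < U - ((hubbardTorus 2 L 1 U).minEnergyOn (szSector (Λ := FermionTorus 2 L) N 0) -
          (hubbardTorus 2 L 1 U).minEnergyOn (szSector (Λ := FermionTorus 2 L) (N - 2) 0)) →
          etaLower torusStagger *ᵥ ψ = 0 :=
  fun _ _ hL U _ _ hN hψ hw => etaLower_groundState_eq_zero_of_window hL U hN hψ hw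

end Torus

end Summit.HubbardSuperconductivity.HubbardSuperconductivity.Theorems.NoOnsiteODLRO.Pseudospin

end
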